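import Literature.Geometry.Kaehler.CyclotomicDegreeLeTwelveHodgeConjectureComplete
import Literature.Geometry.Kaehler.CyclotomicFortyHodgeConjecture
import Literature.Geometry.Kaehler.CyclotomicFortyEightHodgeConjecture
import Literature.Geometry.Kaehler.CyclotomicSixtyHodgeConjecture
import Literature.AlgebraicGeometry.ComplexMultiplication.CyclicTwoPowerCMTypesFermat
import HarnessLib

/-!
# The cyclotomic fields of degree `≤ 16`, COMPLETE: for every abelian variety with complex multiplication by `ℚ(ζ_d)`, `φ(d) ≤ 16`, EITHER the Hodge
# conjecture holds for all its powers, OR `d ∈ {21, 28, 36, 42}` and it is a simple sixfold with `B³ ≠ D³`, OR `d ∈ {32, 40, 48, 60}` and it is a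
# simple `8`-fold with `B⁴ ≠ D⁴` or `B² ≠ D²`

Layer `Literature/Geometry/Kaehler`, namespace `Literature.Geometry.Kaehler.ComplexTorus`; lane `lit-hodgefound` (Track 2 foundations library), prover
seat `lit-hodgefound-p10`, generation 34 (addendum), closing row «A2-26 (φ(d) ≤ 16 complete)» (self-proposed 2026-08-28).  Theorems only (net debt 0).

`φ(d) ≤ 16` and `d > 2` means `φ(d) ≤ 12` (this generation's `CyclotomicDegreeLeTwelveHodgeConjectureComplete`) or `φ(d) = 16` (`φ(d) = 14` has no
solution, §1), i.e. `d ∈ {17, 32, 34, 40, 48, 60}` (§1, `totient_eq_sixteen_iff`).  For `ℚ(ζ₁₇) = ℚ(ζ₃₄)` the Galois group is CYCLIC of order `16` and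
every CM type is nondegenerate (the tree's `CyclicTwoPowerCMTypesFermat`); for `ℚ(ζ₃₂)`, `ℚ(ζ₄₀)`, `ℚ(ζ₄₈)`, `ℚ(ζ₆₀)` (Galois group a NON-cyclic `2`-group)
this generation's `Cyclotomic{ThirtyTwo, Forty, FortyEight, Sixty}HodgeConjecture` give the dichotomy: `96 ∕ 64 ∕ 64 ∕ 64` of the `256` types are primitive and
coset-balanced (Weil type `(4,4)` over an imaginary quadratic subfield, or balanced over a `(−1)`-free subgroup of order `4`), their varieties are
SIMPLE `8`-FOLDS WITH `B⁴ ⊗ ℂ ≠ D⁴ ⊗ ℂ` or `B² ⊗ ℂ ≠ D² ⊗ ℂ`; all other types give varieties satisfying the Hodge conjecture with all their powers.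

* §1 `dvd_of_totient_eq_sixteen`, **`totient_eq_sixteen_iff`** (`d ∈ {17, 32, 34, 40, 48, 60}`), `totient_ne_fourteen`.
* §2 **`hodgeConjectureFor_pow_or_exceptional_of_totient_le_sixteen`** — THE TRICHOTOMY for every `d > 2` with `φ(d) ≤ 16`, every `ℚ(ζ_d)`, every CM
  type, every realisation `A`; `hodgeConjectureFor_pow_of_not_isSimple_of_totient_le_sixteen` (every NON-SIMPLE such variety satisfies the Hodge
  conjecture with all its powers); `hodgeConjectureFor_pow_of_hodgeClassSpan_eq_of_totient_le_sixteen` (`B² = D²`, `B³ = D³`, `B⁴ = D⁴` suffice);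
  `hodgeConjectureFor_or_exceptional_of_totient_le_sixteen` (`A` itself); **`exists_isSimple_exceptional_of_totient_eq_sixteen`** (for each
  `d ∈ {32, 40, 48, 60}` the new branch is inhabited twice: simple CM `8`-folds by `𝓞_{ℚ(ζ_d)}` with `B⁴ ≠ D⁴`, and with `B² ≠ D²`).
* §3 tori: `cyclotomic_seventeen_int`, `cyclotomic_thirtyFour_int`, `charpoly_neg_eq_cyclotomic_seventeen_of_charpoly_eq_cyclotomic_thirtyFour`;
  **`divisorClasses_powPeriod_eq_hodgeClasses_of_charpoly_eq_cyclotomic_of_totient_le_sixteen'`** — `Hdg(Xᵏ) = Div(Xᵏ)` for all `k` for every complex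
  torus with an endomorphism of characteristic polynomial `Φ_d`, `d > 2`, `φ(d) ≤ 16`, PROVIDED `rank MT(X) = 7` resp. `9` when `X` is simple and
  `d ∈ {21, 28, 36, 42}` resp. `{32, 40, 48, 60}`; `mtRank_hodgeStructure_mem_of_isSimple_of_totient_eq_sixteen` (for those simple `X`:
  `rank MT ∈ {9, 8, 7}`, `8` only for `d = 32`, and `Hdg = Div` on all powers iff `9`).

HONEST SCOPE: the Hodge conjecture for the simple degenerate `8`-folds themselves (algebraicity of their Weil resp. generalised Weil classes) is not
asserted anywhere in the tree.

## References

* [Gordon1999HodgeAVSurvey] B. B. Gordon (1999), 5.13 (ii), Thm. 6.3, Thm. 6.4, 7.5, §9.3, §9.4.2 (Lenstra's `ℚ(ζ₃₂)` types), 9.4.3.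
* [Kubota1965] T. Kubota, Trans. AMS 118 (1965), §4 Lemma 2 (`ℚ(ζ₁₇)`).
* [Dodson1984] B. Dodson, Trans. AMS 283 (1984), Thm. 3.2.1.
* [Shimura1998] G. Shimura (1998), §6.2 Thm. 3, §8.2 Prop. 26, §8.4.
* [MoonenZarhin1999LowDim] B. Moonen, Yu. Zarhin, Math. Ann. 315 (1999), Thm. 0.1, §2 (2.7).
* [Washington1997] L. C. Washington, *Introduction to Cyclotomic Fields*, Ch. 2 (Thm. 2.5).
* [BirkenhakeLange2004] C. Birkenhake, H. Lange, *Complex Abelian Varieties*, §13.3 Cor. 13.3.4.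
-/

noncomputable section

open scoped Classical nonZeroDivisors NumberField Manifold ContDiff MatrixGroups
open NumberField Module Polynomial CategoryTheory CategoryTheory.Limits

namespace Literature.Geometry.Kaehler

namespace ComplexTorus

-- `open scoped`: the tree's action of `Aut(ℂ)` on `Hom(K, ℂ)` by composition (`ringEquivCompAction`) is a scoped instance
open scoped Literature.NumberTheory.ComplexMultiplication
open Literature.AlgebraicGeometry.Motives (CMType AbelianVariety HodgeTensorFacts)
open Literature.AlgebraicGeometry.HodgeTheory (HodgeConjectureFor complexBetti)
open Literature.AlgebraicGeometry.VanGeemen1994 (hodgeClassSpan)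
open Literature.Barriers.HodgeConjecture (divisorClassesSpan)
open Literature.NumberTheory.ComplexMultiplication (IsPrimitive)
open Literature.NumberTheory.ComplexMultiplication.CMTypeLattice (periodIso basisIndex card_basisIndex_eq_finrank isSimple_periodIso_iff_isPrimitive
  isAbelianVariety_periodIso)
open Literature.AlgebraicGeometry.Pohlmann1968 (cmTypeRank IsNondegenerate isNondegenerate_iff)
open Literature.AlgebraicGeometry.Pohlmann1968.Cyclotomic (finrank_eq_totient)
open Literature.AlgebraicGeometry.ComplexMultiplication (IsCMTypeRealisation)
open Literature.AlgebraicGeometry.ComplexMultiplication.CMTorus (mtRank_hodgeStructure_periodIso_eq_cmTypeRank)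
open Literature.AlgebraicGeometry.ComplexMultiplication.CyclicTwoPower (cm_normal_cyclic_finrank_of_fermatPrime rank_and_isPrimitive_of_fermatPrime
  isSimple_and_dim_of_fermatPrime hodgeClassSpan_pow_eq_divisorClassesSpan_of_isCyclic hodgeConjectureFor_pow_of_isCyclic)
open Literature.NumberTheory.Automorphic.Arthur2013.Leaves.TECR.TorusDict (isCyclotomicExtension_of_two_mul_of_odd)

/-! ### §1 `φ(d) = 16` and `φ(d) ≠ 14` -/

/-- **`φ(d) = 16 ⟹ d ∣ 8160 = 2⁵·3·5·17`**: for each prime power `p^k ∥ d`, `φ(p^k) = p^{k-1}(p-1) ∣ 16`, whence `p ∈ {2, 3, 5, 17}` with `k ≤ 5, 1, 1, 1`.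
[cite: Washington1997, Ch. 2] [folklore] -/
theorem dvd_of_totient_eq_sixteen {d : ℕ} (h : Nat.totient d = 16) : d ∣ 8160 := by
  have hd0 : d ≠ 0 := by rintro rfl; simp at h
  rw [← Nat.factorization_le_iff_dvd hd0 (by norm_num), Finsupp.le_def]
  intro p
  by_cases hp : p.Prime
  swap
  · rw [Nat.factorization_eq_zero_of_not_prime d hp]; exact Nat.zero_le _
  set k := d.factorization p with hk
  rcases Nat.eq_zero_or_pos k with hk0 | hkpos
  · rw [hk0]; exact Nat.zero_le _
  have hpk : p ^ k ∣ d := Nat.ordProj_dvd d p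
  have hφ : p ^ (k - 1) * (p - 1) ∣ 16 := by
    rw [← Nat.totient_prime_pow hp hkpos, ← h]; exact Nat.totient_dvd_of_dvd hpk
  have hp1 : p - 1 ∣ 16 := (Dvd.intro_left _ rfl).trans hφ
  have hp17 : p ≤ 17 := by have := Nat.le_of_dvd (by norm_num) hp1; omega
  have hpow : p ^ (k - 1) ∣ 16 := (Dvd.intro _ rfl).trans hφ
  rw [← hp.pow_dvd_iff_le_factorization (by norm_num)]
  have h2 := hp.two_le
  interval_cases p
  · -- p = 2 : k ≤ 5
    have hk5 : k ≤ 5 := by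
      by_contra hc
      have h32 : (2 : ℕ) ^ 5 ∣ 16 := (pow_dvd_pow 2 (show 5 ≤ k - 1 by omega)).trans hpow
      norm_num at h32
    exact (pow_dvd_pow 2 hk5).trans (by norm_num)
  · -- p = 3 : k = 1
    have hk1 : k = 1 := by
      by_contra hc
      have h3 : (3 : ℕ) ^ 1 ∣ 16 := (pow_dvd_pow 3 (show 1 ≤ k - 1 by omega)).trans hpow
      norm_num at h3
    rw [hk1]; norm_num
  · exact absurd hp (by norm_num)
  · -- p = 5 : k = 1
    have hk1 : k = 1 := by
      by_contra hc
      have h5 : (5 : ℕ) ^ 1 ∣ 16 := (pow_dvd_pow 5 (show 1 ≤ k - 1 by omega)).trans hpow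
      norm_num at h5
    rw [hk1]; norm_num
  · exact absurd hp (by norm_num)
  · -- p = 7 : `6 ∣ 16`, impossible
    omega
  · exact absurd hp (by norm_num)
  · exact absurd hp (by norm_num)
  · exact absurd hp (by norm_num)
  · -- p = 11 : `10 ∣ 16`, impossible
    omega
  · exact absurd hp (by norm_num)
  · -- p = 13 : `12 ∣ 16`, impossible
    omega
  · exact absurd hp (by norm_num)
  · exact absurd hp (by norm_num)
  · exact absurd hp (by norm_num)
  · -- p = 17 : k = 1
    have hk1 : k = 1 := by
      by_contra hc
      have h17 : (17 : ℕ) ^ 1 ∣ 16 := (pow_dvd_pow 17 (show 1 ≤ k - 1 by omega)).trans hpow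
      norm_num at h17
    rw [hk1]; norm_num

set_option maxRecDepth 100000 in
/-- **`φ(d) = 16 ⟹ d ∈ {17, 32, 34, 40, 48, 60}`** (inspection of the `48` divisors of `8160`, by kernel decision). [cite: Washington1997, Ch. 2] [folklore] -/
theorem eq_of_totient_eq_sixteen {d : ℕ} (h : Nat.totient d = 16) : d = 17 ∨ d = 32 ∨ d = 34 ∨ d = 40 ∨ d = 48 ∨ d = 60 := by
  have hmem : d ∈ Nat.divisors 8160 := Nat.mem_divisors.2 ⟨dvd_of_totient_eq_sixteen h, by norm_num⟩
  have key : ∀ x ∈ Nat.divisors 8160, Nat.totient x = 16 → x = 17 ∨ x = 32 ∨ x = 34 ∨ x = 40 ∨ x = 48 ∨ x = 60 := by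
    decide +kernel
  exact key d hmem h

/-- **`φ(d) = 16 ⟺ d ∈ {17, 32, 34, 40, 48, 60}`.** [cite: Washington1997, Ch. 2] [folklore] -/
theorem totient_eq_sixteen_iff {d : ℕ} : Nat.totient d = 16 ↔ d = 17 ∨ d = 32 ∨ d = 34 ∨ d = 40 ∨ d = 48 ∨ d = 60 := by
  refine ⟨eq_of_totient_eq_sixteen, ?_⟩
  rintro (rfl | rfl | rfl | rfl | rfl | rfl) <;> decide +kernel

/-- **`φ(d) ≠ 14`** (`p − 1 ∣ 14` forces `p ∈ {2, 3}`, then `d ∣ 12`). [cite: Washington1997, Ch. 2] [folklore] -/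
theorem totient_ne_fourteen (d : ℕ) : Nat.totient d ≠ 14 := by
  intro h
  have hd0 : d ≠ 0 := by rintro rfl; simp at h
  have hdvd : d ∣ 12 := by
    rw [← Nat.factorization_le_iff_dvd hd0 (by norm_num), Finsupp.le_def]
    intro p
    by_cases hp : p.Prime
    swap
    · rw [Nat.factorization_eq_zero_of_not_prime d hp]; exact Nat.zero_le _
    set k := d.factorization p with hk
    rcases Nat.eq_zero_or_pos k with hk0 | hkpos
    · rw [hk0]; exact Nat.zero_le _
    have hpk : p ^ k ∣ d := Nat.ordProj_dvd d p
    have hφ : p ^ (k - 1) * (p - 1) ∣ 14 := by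
      rw [← Nat.totient_prime_pow hp hkpos, ← h]; exact Nat.totient_dvd_of_dvd hpk
    have hp1 : p - 1 ∣ 14 := (Dvd.intro_left _ rfl).trans hφ
    have hp15 : p ≤ 15 := by have := Nat.le_of_dvd (by norm_num) hp1; omega
    have hpow : p ^ (k - 1) ∣ 14 := (Dvd.intro _ rfl).trans hφ
    rw [← hp.pow_dvd_iff_le_factorization (by norm_num)]
    have h2 := hp.two_le
    interval_cases p
    · -- p = 2 : k ≤ 2
      have hk2 : k ≤ 2 := by
        by_contra hc
        have h4 : (2 : ℕ) ^ 2 ∣ 14 := (pow_dvd_pow 2 (show 2 ≤ k - 1 by omega)).trans hpow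
        norm_num at h4
      exact (pow_dvd_pow 2 hk2).trans (by norm_num)
    · -- p = 3 : k = 1
      have hk1 : k = 1 := by
        by_contra hc
        have h3 : (3 : ℕ) ^ 1 ∣ 14 := (pow_dvd_pow 3 (show 1 ≤ k - 1 by omega)).trans hpow
        norm_num at h3
      rw [hk1]; norm_num
    · exact absurd hp (by norm_num)
    · -- p = 5 : `4 ∣ 14`, impossible
      omega
    · exact absurd hp (by norm_num)
    · -- p = 7 : `6 ∣ 14`, impossible
      omega
    · exact absurd hp (by norm_num)
    · exact absurd hp (by norm_num)
    · exact absurd hp (by norm_num)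
    · -- p = 11 : `10 ∣ 14`, impossible
      omega
    · exact absurd hp (by norm_num)
    · -- p = 13 : `12 ∣ 14`, impossible
      omega
    · exact absurd hp (by norm_num)
    · exact absurd hp (by norm_num)
  have hmem : d ∈ Nat.divisors 12 := Nat.mem_divisors.2 ⟨hdvd, by norm_num⟩
  have key : ∀ x ∈ Nat.divisors 12, Nat.totient x ≠ 14 := by decide +kernel
  exact key d hmem h

/-- `d > 2`, `12 < φ(d) ≤ 16` ⟹ `φ(d) = 16`. [folklore] -/
private theorem totient_eq_sixteen_of_lt_of_le {d : ℕ} (hd : 2 < d) (h12 : 12 < Nat.totient d) (h16 : Nat.totient d ≤ 16) :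
    Nat.totient d = 16 := by
  obtain ⟨r, hr⟩ := Nat.totient_even hd
  have h14 := totient_ne_fourteen d
  omega

/-! ### §2 Varieties -/

section Varieties

variable {d : ℕ} {K : Type} [Field K] [NumberField K]
  {A : AbelianVariety ℂ} {ι : 𝓞 K →+* End A} {θ : K →+* Module.End ℂ (complexBetti A.X 1)}

/-- `Bᵐ ⊗ ℂ = Dᵐ ⊗ ℂ` for all `m` on an abelian variety gives the Hodge conjecture for it. [cite: Gordon1999HodgeAVSurvey, §9.3] -/
private theorem hodgeConjectureFor_of_forall_hodgeClassSpan_eq₈₁ (B : AbelianVariety ℂ)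
    (h : ∀ m : ℕ, hodgeClassSpan B.dim B.X m = divisorClassesSpan B.X B.dim m) : HodgeConjectureFor B.dim B.X :=
  ⟨Literature.AlgebraicGeometry.HodgeTheory.nonempty_hodgeModel_holds
      (Literature.AlgebraicGeometry.Motives.AbelianVariety.isSmoothProjective_holds (A := B)),
    fun m _ hc hmm ↦ Literature.AlgebraicGeometry.HodgeTheory.AbelianVariety.divisorClassesSpan_le_algebraicClasses B
      (fun b hb hb' ↦ Literature.AlgebraicGeometry.HodgeTheory.lefschetzOneOne_rational_holds
        (Literature.AlgebraicGeometry.Motives.AbelianVariety.isSmoothProjective_holds (A := B)) b hb hb') m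
      ((h m) ▸ Submodule.subset_span ⟨hc, hmm⟩)⟩

/-- **`ℚ(ζ₁₇)`: `B•(Aⁿ) ⊗ ℂ = D•(Aⁿ) ⊗ ℂ` and the Hodge conjecture for all powers, for every type** (cyclic Galois group of order `16`: every type
nondegenerate). [cite: Kubota1965, §4 Lemma 2] [cite: Gordon1999HodgeAVSurvey, Thm. 6.4 and §9.3] -/
theorem hodgeClassSpan_pow_eq_and_hodgeConjectureFor_pow_seventeen (hK : IsCyclotomicExtension {17} ℚ K) (Φ : CMType K)
    (hA : IsCMTypeRealisation Φ A ι θ) (n : ℕ) :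
    (∀ m : ℕ, hodgeClassSpan (⨁ fun _ : Fin n => A).dim (⨁ fun _ : Fin n => A).X m =
        divisorClassesSpan (⨁ fun _ : Fin n => A).X (⨁ fun _ : Fin n => A).dim m) ∧
      HodgeConjectureFor (⨁ fun _ : Fin n => A).dim (⨁ fun _ : Fin n => A).X := by
  obtain ⟨hcm, hno, hcyc, hK'⟩ := cm_normal_cyclic_finrank_of_fermatPrime (k := 3) (by norm_num : Nat.Prime 17) (by norm_num) K
  haveI := hcm
  haveI := hno
  exact ⟨fun m ↦ hodgeClassSpan_pow_eq_divisorClassesSpan_of_isCyclic hcyc hK' hA n m, hodgeConjectureFor_pow_of_isCyclic hcyc hK' hA n⟩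

/-- `ℚ(ζ₃₄) = ℚ(ζ₁₇)`. [cite: Washington1997, Ch. 2] [folklore] -/
theorem isCyclotomicExtension_seventeen_of_thirtyFour (hK : IsCyclotomicExtension {34} ℚ K) : IsCyclotomicExtension {17} ℚ K := by
  haveI : IsCyclotomicExtension {2 * 17} ℚ K := hK
  exact isCyclotomicExtension_of_two_mul_of_odd (K := K) (by decide)

/-- **THE TRICHOTOMY FOR THE CM ABELIAN VARIETIES OF THE CYCLOTOMIC FIELDS OF DEGREE `≤ 16`.**  Let `d > 2`, `φ(d) ≤ 16`, `K = ℚ(ζ_d)`, `Φ` any CM type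
of `K` and `(A, ι, θ)` any realisation.  Then EITHER `B•(Aⁿ) ⊗ ℂ = D•(Aⁿ) ⊗ ℂ` for all `n` and the Hodge conjecture holds for every power of `A`, OR
`d ∈ {21, 28, 36, 42}`, `A` is simple of dimension `6` and `B³(A) ⊗ ℂ ≠ D³(A) ⊗ ℂ` (Dodson's degenerate types, Weil type `(3,3)`), OR
`d ∈ {32, 40, 48, 60}`, `A` is simple of dimension `8` and `B⁴(A) ⊗ ℂ ≠ D⁴(A) ⊗ ℂ` or `B²(A) ⊗ ℂ ≠ D²(A) ⊗ ℂ` (the degenerate primitive types of the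
non-cyclic `2`-groups: Weil type `(4,4)`, or balanced over a `(−1)`-free subgroup of order `4` — among them Lenstra's `ℚ(ζ₃₂)` types).
[cite: Gordon1999HodgeAVSurvey, Thm. 6.3, Thm. 6.4, §9.3, 5.13 (ii) and §9.4.2] [cite: Dodson1984, Thm. 3.2.1] [cite: Kubota1965, §4 Lemma 2] -/
theorem hodgeConjectureFor_pow_or_exceptional_of_totient_le_sixteen (hK : IsCyclotomicExtension {d} ℚ K) (hd : 2 < d)
    (h16 : Nat.totient d ≤ 16) (Φ : CMType K) (hA : IsCMTypeRealisation Φ A ι θ) :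
    ((∀ n m : ℕ, hodgeClassSpan (⨁ fun _ : Fin n => A).dim (⨁ fun _ : Fin n => A).X m =
        divisorClassesSpan (⨁ fun _ : Fin n => A).X (⨁ fun _ : Fin n => A).dim m) ∧
      ∀ n : ℕ, HodgeConjectureFor (⨁ fun _ : Fin n => A).dim (⨁ fun _ : Fin n => A).X) ∨
    ((d = 21 ∨ d = 28 ∨ d = 36 ∨ d = 42) ∧ A.IsSimple ∧ A.dim = 6 ∧ hodgeClassSpan 6 A.X 3 ≠ divisorClassesSpan A.X 6 3) ∨
    ((d = 32 ∨ d = 40 ∨ d = 48 ∨ d = 60) ∧ A.IsSimple ∧ A.dim = 8 ∧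
      (hodgeClassSpan 8 A.X 4 ≠ divisorClassesSpan A.X 8 4 ∨ hodgeClassSpan 8 A.X 2 ≠ divisorClassesSpan A.X 8 2)) := by
  obtain ⟨φ₀⟩ : Nonempty (K →+* ℂ) := inferInstance
  by_cases h12 : Nat.totient d ≤ 12
  · rcases hodgeConjectureFor_pow_or_exceptional_of_totient_le_twelve hK hd h12 Φ hA with h | h
    · exact Or.inl h
    · exact Or.inr (Or.inl h)
  · have h16' : Nat.totient d = 16 := totient_eq_sixteen_of_lt_of_le hd (by omega) h16
    rcases eq_of_totient_eq_sixteen h16' with rfl | rfl | rfl | rfl | rfl | rfl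
    · exact Or.inl ⟨fun n m ↦ (hodgeClassSpan_pow_eq_and_hodgeConjectureFor_pow_seventeen hK Φ hA n).1 m,
        fun n ↦ (hodgeClassSpan_pow_eq_and_hodgeConjectureFor_pow_seventeen hK Φ hA n).2⟩
    · rcases hodgeConjectureFor_pow_or_exceptional_thirtyTwo hK Φ φ₀ hA with h | ⟨-, -, hS, hdim, hne⟩
      · exact Or.inl h
      · exact Or.inr (Or.inr ⟨Or.inl rfl, hS, hdim, hne⟩)
    · have hK' := isCyclotomicExtension_seventeen_of_thirtyFour hK
      exact Or.inl ⟨fun n m ↦ (hodgeClassSpan_pow_eq_and_hodgeConjectureFor_pow_seventeen hK' Φ hA n).1 m,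
        fun n ↦ (hodgeClassSpan_pow_eq_and_hodgeConjectureFor_pow_seventeen hK' Φ hA n).2⟩
    · rcases hodgeConjectureFor_pow_or_exceptional_forty hK Φ φ₀ hA with h | ⟨-, -, hS, hdim, hne⟩
      · exact Or.inl h
      · exact Or.inr (Or.inr ⟨Or.inr (Or.inl rfl), hS, hdim, hne⟩)
    · rcases hodgeConjectureFor_pow_or_exceptional_fortyEight hK Φ φ₀ hA with h | ⟨-, -, hS, hdim, hne⟩
      · exact Or.inl h
      · exact Or.inr (Or.inr ⟨Or.inr (Or.inr (Or.inl rfl)), hS, hdim, hne⟩)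
    · rcases hodgeConjectureFor_pow_or_exceptional_sixty hK Φ φ₀ hA with h | ⟨-, -, hS, hdim, hne⟩
      · exact Or.inl h
      · exact Or.inr (Or.inr ⟨Or.inr (Or.inr (Or.inr rfl)), hS, hdim, hne⟩)

/-- **Every NON-SIMPLE abelian variety with complex multiplication by a cyclotomic field of degree `≤ 16` satisfies the Hodge conjecture with all
its powers** (and `B = D` on all of them). [cite: Gordon1999HodgeAVSurvey, Thm. 6.3 and §9.3] [cite: MoonenZarhin1999LowDim, Thm. 0.1] -/
theorem hodgeConjectureFor_pow_of_not_isSimple_of_totient_le_sixteen (hK : IsCyclotomicExtension {d} ℚ K) (hd : 2 < d)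
    (h16 : Nat.totient d ≤ 16) (Φ : CMType K) (hA : IsCMTypeRealisation Φ A ι θ) (hns : ¬ A.IsSimple) (n : ℕ) :
    (∀ m : ℕ, hodgeClassSpan (⨁ fun _ : Fin n => A).dim (⨁ fun _ : Fin n => A).X m =
        divisorClassesSpan (⨁ fun _ : Fin n => A).X (⨁ fun _ : Fin n => A).dim m) ∧
      HodgeConjectureFor (⨁ fun _ : Fin n => A).dim (⨁ fun _ : Fin n => A).X := by
  rcases hodgeConjectureFor_pow_or_exceptional_of_totient_le_sixteen hK hd h16 Φ hA with ⟨h1, h2⟩ | ⟨-, hS, -⟩ | ⟨-, hS, -⟩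
  · exact ⟨h1 n, h2 n⟩
  · exact absurd hS hns
  · exact absurd hS hns

/-- **`B² = D²`, `B³ = D³` and `B⁴ = D⁴` (after `⊗ ℂ`) suffice**: an abelian variety with complex multiplication by a cyclotomic field of degree `≤ 16`
whose Hodge classes of weights `4`, `6`, `8` are generated by divisor classes satisfies the Hodge conjecture with all its powers.
[cite: Gordon1999HodgeAVSurvey, §9.3 and 5.13 (ii)] -/
theorem hodgeConjectureFor_pow_of_hodgeClassSpan_eq_of_totient_le_sixteen (hK : IsCyclotomicExtension {d} ℚ K) (hd : 2 < d)
    (h16 : Nat.totient d ≤ 16) (Φ : CMType K) (hA : IsCMTypeRealisation Φ A ι θ)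
    (h2 : hodgeClassSpan A.dim A.X 2 = divisorClassesSpan A.X A.dim 2) (h3 : hodgeClassSpan A.dim A.X 3 = divisorClassesSpan A.X A.dim 3)
    (h4 : hodgeClassSpan A.dim A.X 4 = divisorClassesSpan A.X A.dim 4) (n : ℕ) :
    HodgeConjectureFor (⨁ fun _ : Fin n => A).dim (⨁ fun _ : Fin n => A).X := by
  rcases hodgeConjectureFor_pow_or_exceptional_of_totient_le_sixteen hK hd h16 Φ hA with ⟨-, h⟩ | ⟨-, -, hdim, hne⟩ | ⟨-, -, hdim, hne⟩
  · exact h n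
  · rw [hdim] at h3; exact absurd h3 hne
  · rw [hdim] at h4 h2
    rcases hne with hne | hne
    · exact absurd h4 hne
    · exact absurd h2 hne

/-- **The Hodge conjecture for the variety itself** in the first branch. [cite: Gordon1999HodgeAVSurvey, §9.3] -/
theorem hodgeConjectureFor_or_exceptional_of_totient_le_sixteen (hK : IsCyclotomicExtension {d} ℚ K) (hd : 2 < d)
    (h16 : Nat.totient d ≤ 16) (Φ : CMType K) (hA : IsCMTypeRealisation Φ A ι θ) :
    HodgeConjectureFor A.dim A.X ∨
    ((d = 21 ∨ d = 28 ∨ d = 36 ∨ d = 42) ∧ A.IsSimple ∧ A.dim = 6 ∧ hodgeClassSpan 6 A.X 3 ≠ divisorClassesSpan A.X 6 3) ∨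
    ((d = 32 ∨ d = 40 ∨ d = 48 ∨ d = 60) ∧ A.IsSimple ∧ A.dim = 8 ∧
      (hodgeClassSpan 8 A.X 4 ≠ divisorClassesSpan A.X 8 4 ∨ hodgeClassSpan 8 A.X 2 ≠ divisorClassesSpan A.X 8 2)) := by
  haveI : NeZero d := ⟨by omega⟩
  haveI : IsCMField K := IsCyclotomicExtension.Rat.isCMField K (S := ({d} : Set ℕ)) ⟨d, rfl, hd⟩
  haveI : IsAbelianGalois ℚ K := IsCyclotomicExtension.isAbelianGalois {d} ℚ K
  rcases hodgeConjectureFor_pow_or_exceptional_of_totient_le_sixteen hK hd h16 Φ hA with ⟨h1, -⟩ | h | h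
  · refine Or.inl (hodgeConjectureFor_of_forall_hodgeClassSpan_eq₈₁ A ?_)
    have hdim : A.dim = Module.finrank ℚ K / 2 := Literature.AlgebraicGeometry.Motives.schemeDim_eq_holds hA.1
    rw [hdim]
    exact (Literature.AlgebraicGeometry.Pohlmann1968.forall_pow_hodgeClassSpan_eq_iff_forall_hodgeClassSpan_eq hA).1 h1
  · exact Or.inr (Or.inl h)
  · exact Or.inr (Or.inr h)

/-- **THE NEW BRANCH IS NOT EMPTY**: for each `d ∈ {32, 40, 48, 60}` there are SIMPLE abelian `8`-folds with complex multiplication by `𝓞_{ℚ(ζ_d)}` with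
`B⁴ ≠ D⁴`, with `B² ≠ D²`, and ones all of whose powers satisfy the Hodge conjecture. [cite: Shimura1998, §6.2 Thm. 3] [cite: Gordon1999HodgeAVSurvey, §9.4.2] -/
theorem exists_isSimple_exceptional_of_totient_eq_sixteen (hK : IsCyclotomicExtension {d} ℚ K) (hd : d = 32 ∨ d = 40 ∨ d = 48 ∨ d = 60) :
    (∃ (Φ : CMType K) (A : AbelianVariety ℂ) (ι' : 𝓞 K →+* End A) (θ' : K →+* Module.End ℂ (complexBetti A.X 1)),
      IsCMTypeRealisation Φ A ι' θ' ∧ A.IsSimple ∧ A.dim = 8 ∧ hodgeClassSpan 8 A.X 4 ≠ divisorClassesSpan A.X 8 4) ∧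
    (∃ (Φ : CMType K) (A : AbelianVariety ℂ) (ι' : 𝓞 K →+* End A) (θ' : K →+* Module.End ℂ (complexBetti A.X 1)),
      IsCMTypeRealisation Φ A ι' θ' ∧ A.IsSimple ∧ A.dim = 8 ∧ hodgeClassSpan 8 A.X 2 ≠ divisorClassesSpan A.X 8 2) ∧
    (∃ (Φ : CMType K) (A : AbelianVariety ℂ) (ι' : 𝓞 K →+* End A) (θ' : K →+* Module.End ℂ (complexBetti A.X 1)),
      IsCMTypeRealisation Φ A ι' θ' ∧ A.IsSimple ∧ A.dim = 8 ∧
        ∀ n : ℕ, HodgeConjectureFor (⨁ fun _ : Fin n => A).dim (⨁ fun _ : Fin n => A).X) := by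
  rcases hd with rfl | rfl | rfl | rfl
  · haveI := hK; exact exists_isSimple_exceptional_thirtyTwo K
  · haveI := hK; exact exists_isSimple_exceptional_forty K
  · haveI := hK; exact exists_isSimple_exceptional_fortyEight K
  · haveI := hK; exact exists_isSimple_exceptional_sixty K

end Varieties

/-! ### §3 Complex tori with `P_u = Φ_d`, `φ(d) ≤ 16` -/

/-- **`Φ₁₇ = X¹⁶ + X¹⁵ + ⋯ + X + 1`.** [cite: Washington1997, Ch. 2] -/
theorem cyclotomic_seventeen_int : cyclotomic 17 ℤ = X ^ 16 + X ^ 15 + X ^ 14 + X ^ 13 + X ^ 12 + X ^ 11 + X ^ 10 + X ^ 9 + X ^ 8 + X ^ 7 +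
    X ^ 6 + X ^ 5 + X ^ 4 + X ^ 3 + X ^ 2 + X + 1 := by
  haveI : Fact (Nat.Prime 17) := ⟨by norm_num⟩
  rw [cyclotomic_prime ℤ 17]
  simp [Finset.sum_range_succ]
  ring

/-- **`Φ₃₄ = X¹⁶ − X¹⁵ + ⋯ − X + 1`** (from `Φ₁₇(X²) = Φ₃₄ Φ₁₇`). [cite: Washington1997, Ch. 2] -/
theorem cyclotomic_thirtyFour_int : cyclotomic 34 ℤ = X ^ 16 - X ^ 15 + X ^ 14 - X ^ 13 + X ^ 12 - X ^ 11 + X ^ 10 - X ^ 9 + X ^ 8 - X ^ 7 +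
    X ^ 6 - X ^ 5 + X ^ 4 - X ^ 3 + X ^ 2 - X + 1 := by
  have h := cyclotomic_expand_eq_cyclotomic_mul Nat.prime_two (by norm_num : ¬ 2 ∣ 17) ℤ
  rw [show (17 * 2 : ℕ) = 34 by norm_num, cyclotomic_seventeen_int] at h
  have hexp : expand ℤ 2 (X ^ 16 + X ^ 15 + X ^ 14 + X ^ 13 + X ^ 12 + X ^ 11 + X ^ 10 + X ^ 9 + X ^ 8 + X ^ 7 +
      X ^ 6 + X ^ 5 + X ^ 4 + X ^ 3 + X ^ 2 + X + 1 : ℤ[X]) =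
      X ^ 32 + X ^ 30 + X ^ 28 + X ^ 26 + X ^ 24 + X ^ 22 + X ^ 20 + X ^ 18 + X ^ 16 + X ^ 14 + X ^ 12 + X ^ 10 + X ^ 8 + X ^ 6 +
        X ^ 4 + X ^ 2 + 1 := by
    simp [expand_X]
    ring
  rw [hexp] at h
  have hne : (X ^ 16 + X ^ 15 + X ^ 14 + X ^ 13 + X ^ 12 + X ^ 11 + X ^ 10 + X ^ 9 + X ^ 8 + X ^ 7 +
      X ^ 6 + X ^ 5 + X ^ 4 + X ^ 3 + X ^ 2 + X + 1 : ℤ[X]) ≠ 0 := by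
    rw [← cyclotomic_seventeen_int]; exact cyclotomic_ne_zero 17 ℤ
  apply mul_right_cancel₀ hne
  rw [← h]
  ring

/-- **`Φ₁₇(−X) = Φ₃₄`.** [cite: Washington1997, Ch. 2] -/
theorem cyclotomic_seventeen_comp_neg_X : (cyclotomic 17 ℤ).comp (-X) = cyclotomic 34 ℤ := by
  rw [cyclotomic_seventeen_int, cyclotomic_thirtyFour_int]
  simp [add_comp]
  ring

section MatrixAlgebra

variable {ι : Type} [Fintype ι] [DecidableEq ι]

/-- The minimal-polynomial argument (`Φ_n(−A) = Φ_m(A) = 0`, `Φ_n` irreducible, degrees). [cite: Washington1997, Ch. 2] [cite: BirkenhakeLange2004, §13.3 Cor. 13.3.4] -/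
private theorem charpoly_neg_eq_cyclotomic_of_comp_neg_X₈₁ {m n : ℕ} (hm : 0 < m) (hn : 0 < n)
    (hcomp : (cyclotomic n ℤ).comp (-X) = cyclotomic m ℤ) (htot : Nat.totient n = Nat.totient m) {A : Matrix ι ι ℤ}
    (hP : A.charpoly = cyclotomic m ℤ) : (-A).charpoly = cyclotomic n ℤ := by
  have hcard : Fintype.card ι = Nat.totient m := by
    rw [← Matrix.charpoly_natDegree_eq_dim A, hP, natDegree_cyclotomic]
  have hpos : 0 < Fintype.card ι := by rw [hcard]; exact Nat.totient_pos.2 hm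
  haveI : Nonempty ι := Fintype.card_pos_iff.1 hpos
  set F : Matrix ι ι ℤ →+* Matrix ι ι ℚ := (Int.castRingHom ℚ).mapMatrix with hF
  have hB : (F A).charpoly = cyclotomic m ℚ := by
    rw [hF, RingHom.mapMatrix_apply, Matrix.charpoly_map, hP, map_cyclotomic_int]
  have haeval : aeval (-(F A)) (cyclotomic n ℚ) = 0 := by
    have h1 : aeval (F A) (cyclotomic m ℚ) = 0 := by rw [← hB]; exact Matrix.aeval_self_charpoly _
    have h2 : (cyclotomic n ℚ).comp (-X) = cyclotomic m ℚ := by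
      rw [← map_cyclotomic_int n ℚ, ← map_cyclotomic_int m ℚ, ← hcomp, Polynomial.map_comp]
      simp
    rw [← h2, aeval_comp] at h1
    simpa using h1
  have hmin : minpoly ℚ (-(F A)) = cyclotomic n ℚ :=
    (minpoly.eq_of_irreducible_of_monic (cyclotomic.irreducible_rat hn) haeval (cyclotomic.monic n ℚ)).symm
  have hdvd : cyclotomic n ℚ ∣ (-(F A)).charpoly := hmin ▸ Matrix.minpoly_dvd_charpoly _
  have hQ : (-(F A)).charpoly = cyclotomic n ℚ := by
    refine eq_of_monic_of_dvd_of_natDegree_le (cyclotomic.monic _ ℚ) (Matrix.charpoly_monic _) hdvd ?_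
    rw [Matrix.charpoly_natDegree_eq_dim, natDegree_cyclotomic, hcard, htot]
  apply Polynomial.map_injective (Int.castRingHom ℚ) (Int.castRingHom ℚ).injective_int
  rw [map_cyclotomic_int, ← Matrix.charpoly_map, ← hQ, ← map_neg F A, hF, RingHom.mapMatrix_apply]

/-- **`P_A = Φ₃₄ ⟹ P_{−A} = Φ₁₇`** for an integer matrix `A` (of size `16`). [cite: BirkenhakeLange2004, §13.3 Cor. 13.3.4] [cite: Washington1997, Ch. 2] -/
theorem charpoly_neg_eq_cyclotomic_seventeen_of_charpoly_eq_cyclotomic_thirtyFour {A : Matrix ι ι ℤ}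
    (hP : A.charpoly = cyclotomic 34 ℤ) : (-A).charpoly = cyclotomic 17 ℤ :=
  charpoly_neg_eq_cyclotomic_of_comp_neg_X₈₁ (by norm_num) (by norm_num) cyclotomic_seventeen_comp_neg_X (by decide +kernel) hP

end MatrixAlgebra

section Tori

variable {ι : Type} [Fintype ι] [DecidableEq ι] {E : Type} [NormedAddCommGroup E] [NormedSpace ℂ E]
  {P : (ι → ℝ) ≃L[ℝ] E} {d : ℕ}

set_option backward.isDefEq.respectTransparency false in -- Mathlib's instance
-- `IsCyclotomicExtension {17} ℚ (CyclotomicField 17 ℚ)` is keyed on `CyclotomicField.algebra`, the goal on `DivisionRing.toRatAlgebra`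
/-- **`Hdg(Xᵏ) = Div(Xᵏ)` FOR ALL `k` FOR EVERY COMPLEX TORUS WITH AN ENDOMORPHISM OF CHARACTERISTIC POLYNOMIAL `Φ₁₇`** (`X ≅ ℂ⁸/Φ(𝔞)` is a simple abelian
variety of a NONDEGENERATE type: `rank MT = 9 = dim + 1`). [cite: Kubota1965, §4 Lemma 2] [cite: Gordon1999HodgeAVSurvey, 7.5] [cite: Shimura1998, §6.2 Thm. 3] -/
theorem divisorClasses_powPeriod_eq_hodgeClasses_of_charpoly_eq_cyclotomic_seventeen [HodgeTensorFacts.{0, 0}] {A : Matrix ι ι ℤ}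
    (hA : A ∈ endRingInt P) (hP : A.charpoly = cyclotomic 17 ℤ) (k p : ℕ) :
    divisorClasses (powPeriod P k) p = hodgeClasses (powPeriod P k) p := by
  have hζ := IsCyclotomicExtension.zeta_spec 17 ℚ (CyclotomicField 17 ℚ)
  obtain ⟨Φ, I, e, he, he₂, -⟩ := exists_cmType_ideal_iso_of_charpoly_eq_cyclotomic hζ hA hP
  obtain ⟨hcm, -, -, hK⟩ := cm_normal_cyclic_finrank_of_fermatPrime (k := 3) (by norm_num : Nat.Prime 17) (by norm_num) (CyclotomicField 17 ℚ)
  haveI := hcm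
  obtain ⟨φ₀⟩ : Nonempty (CyclotomicField 17 ℚ →+* ℂ) := inferInstance
  obtain ⟨hr, -, hprim⟩ := rank_and_isPrimitive_of_fermatPrime (k := 3) (by norm_num : Nat.Prime 17) (by norm_num) Φ φ₀
  have hXiso : IsIsomorphic P (periodIso Φ I) := ⟨e, he, he₂⟩
  have hcard : Fintype.card (basisIndex I) = 16 := by rw [card_basisIndex_eq_finrank, hK]; norm_num
  haveI : Nonempty (basisIndex I) := Fintype.card_pos_iff.1 (by omega)
  have hY := isAbelianVariety_periodIso Φ I
  have hS : ComplexTorus.IsSimple (periodIso Φ I) := (isSimple_periodIso_iff_isPrimitive Φ I φ₀).2 hprim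
  refine (hXiso.isIsogenous.forall_powPeriod_divisorClasses_eq_hodgeClasses_iff).2 (fun k' p' ↦ ?_) k p
  refine (hY.forall_powPeriod_divisorClasses_eq_hodgeClasses_iff_mtRank_eq_card_of_isSimple_of_isTorusSubgroup_mumfordTateGroupC hS
    (isTorusSubgroup_mumfordTateGroupC_periodIso Φ I)).2 ?_ k' p'
  rw [mtRank_hodgeStructure_periodIso_eq_cmTypeRank Φ I, hcard, hr]
  norm_num

/-- **`Hdg(Xᵏ) = Div(Xᵏ)` for all `k` for every complex torus with an endomorphism of characteristic polynomial `Φ₃₄`** (through `−u`, `P_{−u} = Φ₁₇`).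
[cite: Kubota1965, §4 Lemma 2] [cite: Gordon1999HodgeAVSurvey, 7.5] -/
theorem divisorClasses_powPeriod_eq_hodgeClasses_of_charpoly_eq_cyclotomic_thirtyFour [HodgeTensorFacts.{0, 0}] {A : Matrix ι ι ℤ}
    (hA : A ∈ endRingInt P) (hP : A.charpoly = cyclotomic 34 ℤ) (k p : ℕ) :
    divisorClasses (powPeriod P k) p = hodgeClasses (powPeriod P k) p :=
  divisorClasses_powPeriod_eq_hodgeClasses_of_charpoly_eq_cyclotomic_seventeen (neg_mem hA)
    (charpoly_neg_eq_cyclotomic_seventeen_of_charpoly_eq_cyclotomic_thirtyFour hP) k p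

/-- **`Hdg(Xᵏ) = Div(Xᵏ)` FOR ALL `k`, FOR EVERY COMPLEX TORUS WITH AN ENDOMORPHISM OF CHARACTERISTIC POLYNOMIAL `Φ_d`, `d > 2`, `φ(d) ≤ 16`** — provided that, when
`X` is simple, `rank MT(X) = 7` if `d ∈ {21, 28, 36, 42}` and `rank MT(X) = 9` if `d ∈ {32, 40, 48, 60}` (in those cases the simple `X` have `rank MT ∈ {7, 6}`
resp. `{9, 8, 7}` and `Hdg = Div` on all powers iff the maximum). [cite: MoonenZarhin1999LowDim, Thm. 0.1] [cite: Gordon1999HodgeAVSurvey, Thm. 6.3 (2), 7.5, §9.4.2]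
[cite: Kubota1965, §4 Lemma 2] -/
theorem divisorClasses_powPeriod_eq_hodgeClasses_of_charpoly_eq_cyclotomic_of_totient_le_sixteen' [HodgeTensorFacts.{0, 0}] (hd : 2 < d)
    (h16 : Nat.totient d ≤ 16) {A : Matrix ι ι ℤ} (hA : A ∈ endRingInt P) (hP : A.charpoly = cyclotomic d ℤ)
    (h7 : (d = 21 ∨ d = 28 ∨ d = 36 ∨ d = 42) → ComplexTorus.IsSimple P → (hodgeStructure P 1).mtRank = 7)
    (h9 : (d = 32 ∨ d = 40 ∨ d = 48 ∨ d = 60) → ComplexTorus.IsSimple P → (hodgeStructure P 1).mtRank = 9) (k p : ℕ) :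
    divisorClasses (powPeriod P k) p = hodgeClasses (powPeriod P k) p := by
  by_cases h12 : Nat.totient d ≤ 12
  · exact divisorClasses_powPeriod_eq_hodgeClasses_of_charpoly_eq_cyclotomic_of_totient_le_twelve' hd h12 hA hP h7 k p
  · have h16' : Nat.totient d = 16 := totient_eq_sixteen_of_lt_of_le hd (by omega) h16
    rcases eq_of_totient_eq_sixteen h16' with rfl | rfl | rfl | rfl | rfl | rfl
    · exact divisorClasses_powPeriod_eq_hodgeClasses_of_charpoly_eq_cyclotomic_seventeen hA hP k p
    · exact divisorClasses_powPeriod_eq_hodgeClasses_of_thirtyTwo hA hP (h9 (Or.inl rfl)) k p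
    · exact divisorClasses_powPeriod_eq_hodgeClasses_of_charpoly_eq_cyclotomic_thirtyFour hA hP k p
    · exact divisorClasses_powPeriod_eq_hodgeClasses_of_forty hA hP (h9 (Or.inr (Or.inl rfl))) k p
    · exact divisorClasses_powPeriod_eq_hodgeClasses_of_fortyEight hA hP (h9 (Or.inr (Or.inr (Or.inl rfl)))) k p
    · exact divisorClasses_powPeriod_eq_hodgeClasses_of_sixty hA hP (h9 (Or.inr (Or.inr (Or.inr rfl)))) k p

/-- **For SIMPLE tori with `P_u = Φ_d`, `d ∈ {32, 40, 48, 60}`: `rank MT(X) ∈ {9, 8, 7}` (`8` only for `d = 32`), and `Hdg = Div` on all powers iff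
`rank MT(X) = 9`.** [cite: Gordon1999HodgeAVSurvey, 7.5 and §9.4.2] [cite: Shimura1998, §6.2 Thm. 3] -/
theorem mtRank_hodgeStructure_mem_of_isSimple_of_totient_eq_sixteen [HodgeTensorFacts.{0, 0}] (hd : d = 32 ∨ d = 40 ∨ d = 48 ∨ d = 60)
    (hX : ComplexTorus.IsSimple P) {A : Matrix ι ι ℤ} (hA : A ∈ endRingInt P) (hP : A.charpoly = cyclotomic d ℤ) :
    ((hodgeStructure P 1).mtRank = 9 ∨ (hodgeStructure P 1).mtRank = 8 ∨ (hodgeStructure P 1).mtRank = 7) ∧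
      (d ≠ 32 → (hodgeStructure P 1).mtRank ≠ 8) ∧
      ((∀ k p : ℕ, divisorClasses (powPeriod P k) p = hodgeClasses (powPeriod P k) p) ↔ (hodgeStructure P 1).mtRank = 9) := by
  rcases hd with rfl | rfl | rfl | rfl
  · obtain ⟨hm, hs⟩ := mtRank_hodgeStructure_mem_and_isSimple_iff_thirtyTwo hA hP
    have h7 := hs.1 hX
    refine ⟨by omega, fun h ↦ absurd rfl h, ?_⟩
    rw [forall_divisorClasses_powPeriod_eq_hodgeClasses_iff_thirtyTwo hA hP]
    exact ⟨fun h ↦ h hX, fun h _ ↦ h⟩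
  · obtain ⟨hm, hs⟩ := mtRank_hodgeStructure_mem_and_isSimple_iff_forty hA hP
    have h7 := hs.1 hX
    refine ⟨by omega, fun _ ↦ by omega, ?_⟩
    rw [forall_divisorClasses_powPeriod_eq_hodgeClasses_iff_forty hA hP]
    exact ⟨fun h ↦ h hX, fun h _ ↦ h⟩
  · obtain ⟨hm, hs⟩ := mtRank_hodgeStructure_mem_and_isSimple_iff_fortyEight hA hP
    have h7 := hs.1 hX
    refine ⟨by omega, fun _ ↦ by omega, ?_⟩
    rw [forall_divisorClasses_powPeriod_eq_hodgeClasses_iff_fortyEight hA hP]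
    exact ⟨fun h ↦ h hX, fun h _ ↦ h⟩
  · obtain ⟨hm, hs⟩ := mtRank_hodgeStructure_mem_and_isSimple_iff_sixty hA hP
    have h7 := hs.1 hX
    refine ⟨by omega, fun _ ↦ by omega, ?_⟩
    rw [forall_divisorClasses_powPeriod_eq_hodgeClasses_iff_sixty hA hP]
    exact ⟨fun h ↦ h hX, fun h _ ↦ h⟩

end Tori

end ComplexTorus

end Literature.Geometry.Kaehler

end
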